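import Literature.AlgebraicGeometry.Resolution.BlowupChartRsop
import Literature.AlgebraicGeometry.Resolution.BlowupDimension
import Literature.AlgebraicGeometry.Resolution.RegularLocalRingsProofs
import HarnessLib

/-!
# [OURS · L1 W4.6, rungs (i)/(ii) — the dictionary, SCHEME HALF, brick 4b] The local ring at a RATIONAL point of
# the exceptional divisor of a point blow-up has dimension `≥ n` (in fact `= n`)

Cell res-hironaka (LADDER-RESOLUTION rung L, D-0089), slot W4.6, seat res-L1-s46-pv-2 (gen 2). Host: route
`WildCones`, crux `ClassicalRegimes` (stmt-ResolutionOfSingularities-16884), `--supports … --as helper`.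

HONEST FRAMING. Everything here is OURS and is ordinary commutative algebra about the tree's chart rings of a
blowing up (`Literature/AlgebraicGeometry/Resolution/BlowupChartRsop.lean`); NOTHING here is a statement of
H. Hironaka's manuscript [Hironaka2017] and nothing of it is used; no FACT-LIST premise. AI review is weaker than
expert review.

## What this brick supplies

Hypothesis `hdim` of formal-chart recognition (`Theorems/WildConesCampaignW46FormalChart.lean`): the completed
local ring `C = 𝒪̂_{Z′,ξ′}` has dimension (at least) `n = dim Z`. Since completion preserves dimension
(`ringKrullDim_adicCompletion`, `AdicCompletionRegular.lean`), what is needed is `n ≤ dim 𝒪_{Z′,ξ′}`; by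
`IsBlowup.exists_reesChart_stalk` the stalk is a localisation `L` of a chart ring at a prime `𝔓` over `𝔪_R`,
`R = 𝒪_{Z,ξ}` regular local of dimension `n` with regular system of parameters `c`. For a `κ`-RATIONAL point
(`u_j − ψ τ_j ∈ 𝔓`, `j ≠ i`, cf. brick 4 `…ChartPoint.lean`) we prove `n ≤ dim L` (`le_ringKrullDim_of_rational`):
the `n` elements `(ψ cᵢ, u_j − ψ τ_j)` form an `L`-regular sequence, by the tree's `isRegular_chartFamily` applied to
the SHIFTED regular system of parameters `c′_j = c_j − τ_j cᵢ` (`c′ᵢ = cᵢ`), whose chart quotients are exactly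
the recentred `u_j − ψ τ_j`; the abstract chart datum for `c′` (`ε′ : (R/(c′))[T] ≅ A/(ψ cᵢ)`, `T_j ↦ u_j − ψ τ_j`)
is obtained from the one for `c` by the translation `T_j ↦ T_j − τ̄_j` of the polynomial ring
(`exists_translate`). A regular sequence of length `n` forces `dim L ≥ n`
(`Module.supportDim_add_length_eq_supportDim_of_isRegular`, through the tree's `ringKrullDim_quot_chartFamily_add`).
For the Rees chart the tree's `ringKrullDim_localization_chartRing_le` (Matsumura 15.5) gives the other
inequality, so `dim L = n` there (`ringKrullDim_eq_of_rational_reesChart`).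

As in `BlowupChartRsop.lean` and brick 4, the statements are over ABSTRACT chart data `(A, ψ, u, ε)`.

References: H. Matsumura, *Commutative Ring Theory* (1986), Thms. 15.5, 16.2, 17.4; The Stacks Project, Tag 0BIQ;
`BlowupChartRsop.lean`, `BlowupDimension.lean`. [Matsumura1987] [StacksProject] [folklore]
-/

noncomputable section

-- single-problem summit: the doubled namespace component `ResolutionOfSingularities` is forced
set_option linter.dupNamespace false

open IsLocalRing

namespace Summit.ResolutionOfSingularities.ResolutionOfSingularities.Theorems

namespace CampaignW46.ChartPoint

open Literature.AlgebraicGeometry.Resolution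

universe u

/-! ## Translations of a polynomial ring -/

/-- **Translation automorphism** `T_j ↦ T_j − t_j` of a polynomial ring (inverse `T_j ↦ T_j + t_j`). [folklore] -/
theorem _root_.MvPolynomial.exists_translate {σ : Type*} {S : Type*} [CommRing S] (t : σ → S) :
    ∃ θ : MvPolynomial σ S ≃ₐ[S] MvPolynomial σ S, ∀ j, θ (MvPolynomial.X j) = MvPolynomial.X j - MvPolynomial.C (t j) := by
  refine ⟨AlgEquiv.ofAlgHom (MvPolynomial.aeval fun j => MvPolynomial.X j - MvPolynomial.C (t j))
    (MvPolynomial.aeval fun j => MvPolynomial.X j + MvPolynomial.C (t j)) ?_ ?_, fun j => ?_⟩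
  · apply MvPolynomial.algHom_ext
    intro j
    simp
  · apply MvPolynomial.algHom_ext
    intro j
    simp
  · rw [AlgEquiv.ofAlgHom_apply, MvPolynomial.aeval_X]

/-! ## The shifted regular system of parameters `c′_j = c_j − τ_j cᵢ` -/

section Shift

variable {R : Type u} [CommRing R] {n : ℕ} (c : Fin n → R) (i : Fin n) (τ : Fin n → R)

/-- Both families generate the same ideal. [folklore] -/
theorem span_range_shift_eq [DecidableEq (Fin n)] :
    Ideal.span (Set.range fun j : Fin n => if j = i then c i else c j - τ j * c i) = Ideal.span (Set.range c) := by
  apply le_antisymm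
  · rw [Ideal.span_le]
    rintro _ ⟨j, rfl⟩
    by_cases hj : j = i
    · simp only [hj, if_true]; exact Ideal.subset_span ⟨i, rfl⟩
    · simp only [if_neg hj]
      exact Ideal.sub_mem _ (Ideal.subset_span ⟨j, rfl⟩) (Ideal.mul_mem_left _ _ (Ideal.subset_span ⟨i, rfl⟩))
  · rw [Ideal.span_le]
    rintro _ ⟨j, rfl⟩
    have hi : c i ∈ Ideal.span (Set.range fun j : Fin n => if j = i then c i else c j - τ j * c i) :=
      Ideal.subset_span ⟨i, by simp⟩
    by_cases hj : j = i
    · rw [hj]; exact hi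
    · have h : c j = (c j - τ j * c i) + τ j * c i := by ring
      rw [SetLike.mem_coe, h]
      exact Ideal.add_mem _ (Ideal.subset_span ⟨j, by simp [hj]⟩) (Ideal.mul_mem_left _ _ hi)

end Shift

/-! ## The dimension bound -/

section Abstract

variable {R : Type u} [CommRing R] [IsRegularLocalRing R] {n : ℕ} (c : Fin n → R) (i : Fin n)
  (hz : Ideal.span (Set.range c) = maximalIdeal R) (hd : (maximalIdeal R).spanFinrank = n)
  {A : Type u} [CommRing A] [IsNoetherianRing A] (ψ : R →+* A) (u : Fin n → A)
  (hnzd : ψ (c i) ∈ nonZeroDivisors A)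
  (ε : MvPolynomial {j : Fin n // j ≠ i} (R ⧸ Ideal.span (Set.range c)) ≃+* A ⧸ Ideal.span {ψ (c i)})
  (hεC : ∀ r : R, ε (MvPolynomial.C (Ideal.Quotient.mk (Ideal.span (Set.range c)) r)) =
    Ideal.Quotient.mk _ (ψ r))
  (hεX : ∀ j : {j : Fin n // j ≠ i}, ε (MvPolynomial.X j) = Ideal.Quotient.mk _ (u j.1))
  (𝔓 : Ideal A) [𝔓.IsPrime] (h𝔓 : 𝔓.comap ψ = maximalIdeal R)
  (τ : Fin n → R) (hτ : ∀ j, j ≠ i → u j - ψ (τ j) ∈ 𝔓)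
  (L : Type u) [CommRing L] [IsLocalRing L] [Algebra A L] [IsLocalization.AtPrime L 𝔓]

include hz hd hnzd hεC hεX h𝔓 hτ in
/-- [OURS · L1 W4.6 — DICTIONARY, SCHEME HALF, brick 4b (abstract chart); replaces the role of «`dim Z′ = dim Z` at
the points of the blowup» (H. Hironaka, ms. 2017, Th. 16.6 p.84) AT A RATIONAL POINT; NOT a statement of the
manuscript] **`n ≤ dim L`** for a localisation `L` of a chart of the blow-up of the closed point of an
`n`-dimensional regular local ring at a prime over the closed point that is `κ`-rational: the `n` elements
`ψ cᵢ, u_j − ψ τ_j` form an `L`-regular sequence. [cite: Matsumura1987, Thm. 17.4] [folklore] -/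
theorem le_ringKrullDim_of_rational : (n : WithBot ℕ∞) ≤ ringKrullDim L := by
  classical
  -- the shifted regular system of parameters and its chart datum
  set c' : Fin n → R := fun j => if j = i then c i else c j - τ j * c i with hc'
  have hci : c' i = c i := by rw [hc']; simp
  have hspan : Ideal.span (Set.range c') = Ideal.span (Set.range c) := span_range_shift_eq c i τ
  have hz' : Ideal.span (Set.range (Fin.append c' (Fin.elim0 : Fin 0 → R))) = maximalIdeal R := by
    have hr : Set.range (Fin.append c' (Fin.elim0 : Fin 0 → R)) = Set.range c' := by
      ext x
      simp only [Set.mem_range, Fin.append_elim0, Function.comp_apply]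
      constructor
      · rintro ⟨j, rfl⟩; exact ⟨_, rfl⟩
      · rintro ⟨j, rfl⟩; exact ⟨Fin.cast (Nat.add_zero n).symm j, rfl⟩
    rw [hr, hspan, hz]
  set u' : Fin n → A := fun j => u j - ψ (τ j) with hu'
  have hnzd' : ψ (c' i) ∈ nonZeroDivisors A := by rw [hci]; exact hnzd
  -- `ε′ : (R/(c′))[T] ≅ A/(ψ c′ᵢ)`, `T_j ↦ u_j − ψ τ_j`
  obtain ⟨θ, hθ⟩ := MvPolynomial.exists_translate
    (fun j : {j : Fin n // j ≠ i} => Ideal.Quotient.mk (Ideal.span (Set.range c)) (τ j.1))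
  let ε₁ : MvPolynomial {j : Fin n // j ≠ i} (R ⧸ Ideal.span (Set.range c')) ≃+*
      MvPolynomial {j : Fin n // j ≠ i} (R ⧸ Ideal.span (Set.range c)) :=
    MvPolynomial.mapEquiv _ (Ideal.quotEquivOfEq hspan)
  let ε₃ : A ⧸ Ideal.span {ψ (c i)} ≃+* A ⧸ Ideal.span {ψ (c' i)} := Ideal.quotEquivOfEq (by rw [hci])
  let ε' : MvPolynomial {j : Fin n // j ≠ i} (R ⧸ Ideal.span (Set.range c')) ≃+* A ⧸ Ideal.span {ψ (c' i)} :=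
    (ε₁.trans (θ.toRingEquiv.trans ε)).trans ε₃
  have hεC' : ∀ r : R, ε' (MvPolynomial.C (Ideal.Quotient.mk (Ideal.span (Set.range c')) r)) =
      Ideal.Quotient.mk _ (ψ r) := by
    intro r
    change ε₃ (ε (θ (ε₁ (MvPolynomial.C (Ideal.Quotient.mk (Ideal.span (Set.range c')) r))))) = _
    rw [MvPolynomial.mapEquiv_apply, MvPolynomial.map_C]
    change ε₃ (ε (θ (MvPolynomial.C (Ideal.Quotient.mk (Ideal.span (Set.range c)) r)))) = _
    rw [show θ (MvPolynomial.C (Ideal.Quotient.mk (Ideal.span (Set.range c)) r)) =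
        MvPolynomial.C (Ideal.Quotient.mk (Ideal.span (Set.range c)) r) from θ.commutes _, hεC]
    rfl
  have hεX' : ∀ j : {j : Fin n // j ≠ i}, ε' (MvPolynomial.X j) = Ideal.Quotient.mk _ (u' j.1) := by
    intro j
    change ε₃ (ε (θ (ε₁ (MvPolynomial.X j)))) = _
    rw [MvPolynomial.mapEquiv_apply, MvPolynomial.map_X, hθ, map_sub, hεX, hεC, ← map_sub]
    rfl
  have hτ' : ∀ k : Fin (Fintype.card {j : Fin n // j ≠ i}),
      u' ((Fintype.equivFin {j : Fin n // j ≠ i}).symm k).1 ∈ 𝔓 := fun k =>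
    hτ _ ((Fintype.equivFin {j : Fin n // j ≠ i}).symm k).2
  -- the tree's regular-sequence dimension count for the shifted datum
  have h := ringKrullDim_quot_chartFamily_add c' i (Fin.elim0 : Fin 0 → R) hz' hd L ψ u' hnzd' ε' hεC' hεX' 𝔓 h𝔓
    (Fintype.equivFin {j : Fin n // j ≠ i}).symm (Fintype.equivFin {j : Fin n // j ≠ i}).symm.injective hτ'
  have hcard : Fintype.card {j : Fin n // j ≠ i} + 0 + 1 = n := by
    rw [Fintype.card_subtype_compl, Fintype.card_subtype_eq, Fintype.card_fin]
    have : 1 ≤ n := Nat.succ_le_of_lt (Fin.pos i)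
    omega
  set x := ringKrullDim (L ⧸ Ideal.span (Set.range (chartFamily c' i (Fin.elim0 : Fin 0 → R) L ψ u'
      (Fintype.equivFin {j : Fin n // j ≠ i}).symm))) with hx
  have h2 : ((Fintype.card {j : Fin n // j ≠ i} + 0 + 1 : ℕ) : WithBot ℕ∞) = (n : WithBot ℕ∞) := by
    rw [hcard]
  rw [h2] at h
  -- `dim (L/ζ) ≥ 0` unless `L/ζ = 0`, in which case `dim L = ⊥`, impossible for a local ring
  have hL : (0 : WithBot ℕ∞) ≤ ringKrullDim L := ringKrullDim_nonneg_of_nontrivial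
  rw [← h] at hL ⊢
  clear_value x
  cases x with
  | bot =>
    rw [WithBot.bot_add] at hL
    exact absurd hL (by simp)
  | coe q =>
    exact le_add_of_nonneg_left (WithBot.coe_nonneg.mpr bot_le)

end Abstract

/-! ## The Rees chart: `dim = n` -/

section ReesChart

variable {R : Type u} [CommRing R] [IsRegularLocalRing R] {n : ℕ} (c : Fin n → R) (i : Fin n)
  (hz : Ideal.span (Set.range c) = maximalIdeal R) (hd : (maximalIdeal R).spanFinrank = n)

include hz hd in
/-- [OURS · L1 W4.6 — DICTIONARY, SCHEME HALF, brick 4b for the Rees chart `B = (R[𝔪t])_{(cᵢt)}`; NOT a statement of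
the manuscript] **`dim L = n`** for a localisation `L` of the chart of the blow-up of the closed point of an
`n`-dimensional regular local ring at a `κ`-rational prime over the closed point (`≤` is the tree's
`ringKrullDim_localization_chartRing_le`, Matsumura 15.5; `≥` is `le_ringKrullDim_of_rational`).
[cite: Matsumura1987, Thm. 15.5] [folklore] -/
theorem ringKrullDim_eq_of_rational_reesChart (𝔓 : Ideal (chartRing c i)) [𝔓.IsPrime]
    (h𝔓 : 𝔓.comap (chartBase c i) = maximalIdeal R) (τ : Fin n → R)
    (hτ : ∀ j, j ≠ i → chartGen c i j - chartBase c i (τ j) ∈ 𝔓)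
    (L : Type u) [CommRing L] [IsLocalRing L] [Algebra (chartRing c i) L] [IsLocalization.AtPrime L 𝔓] :
    ringKrullDim L = n := by
  haveI : IsNoetherianRing (chartRing c i) := isNoetherianRing_blowupChart c i
  haveI : IsDomain R := isDomain_of_isRegularLocalRing R
  have hR : ringKrullDim R = n := by rw [← IsRegularLocalRing.spanFinrank_maximalIdeal, hd]
  refine le_antisymm ?_ ?_
  · have h := ringKrullDim_localization_chartRing_le c i 𝔓 h𝔓 L
    rwa [hR] at h
  · exact le_ringKrullDim_of_rational c i hz hd (chartBase c i) (chartGen c i)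
      (reesChartBase_mem_nonZeroDivisors (c i) (Ideal.mem_span_range_self (f := c) (x := i)))
      (chartQuotEquiv c i (isQuasiRegular_rsop_comp hd c hz id Function.injective_id))
      (chartQuotMap_C c i) (chartQuotMap_X c i) 𝔓 h𝔓 τ hτ L

end ReesChart

end CampaignW46.ChartPoint

end Summit.ResolutionOfSingularities.ResolutionOfSingularities.Theorems

end
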